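import Mathlib
import Literature.NumberTheory.LFunctions.Zhang2022.ToolkitLemma56ChiTwist
import Literature.NumberTheory.LFunctions.Zhang2022.SkeletonWindowPowers
import Literature.NumberTheory.LFunctions.Zhang2022.Section5Lemma56Printed
import Literature.NumberTheory.LFunctions.TwistedPrimeSumWindow
import HarnessLib

/-!
# Zhang (2022) toolkit: Lemma 5.6 for `χθ̄` with the smooth twist `(pt₀)^β`, `|β| ≤ 5α`
# (the `p`-sum of (14.8)/(14.6) at GENERAL `β`)

Topic `Literature/NumberTheory/LFunctions/Zhang2022` (Landau–Siegel audit tree; verdict-neutral;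
leaf `Skeleton.Prop141` of the ZHANG-L discharge lane, rows G-L3t7-1 / G-adj2-4).
Y. Zhang, *Discrete mean estimates and the Landau–Siegel zero*, arXiv:2211.02515v1 (2022)
[Zhang2022LandauSiegel] — **an unrefereed manuscript under adjudication**; this file is an ADAPTER
over tree THEOREMS (no Zhang step is restated or asserted; nothing here bears on Theorems 1–2 or on
Landau–Siegel zeros).

Proposition 14.1 (§14 p. 76) is stated for all `|β| < 5α` and proved in print "with `β = 0` only, as
the general case is almost identical". At general `β` the character sum over the window that the
first `r`-range of (14.8) feeds to Lemma 5.6 ("for `1 < r < D³` we use the Mellin transform, Lemma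
5.4 (i) and Lemma 5.6", p. 79, tex L3960) carries the extra factor `(pt₀)^β`:
`Σ_{p∼P} χθ̄(p)(pt₀)^β p^{1+it}`. Its imaginary part `p^{i Im β}` merges into `t`; its real part
`p^{Re β}`, `|Re β| ≤ 5α = 5π/log P`, is a bounded MONOTONE weight on the window, removed by discrete
Abel summation against the SUB-WINDOW form of Lemma 5.6 that the tree proves
(`Zhang2022.lemma56`, `Section5PrimeSums`: uniform over `P < p ≤ u`, `u ≤ P(1+𝓛⁻⁶⁸)`).

* `norm_sum_Ioc_mul_le_of_antitone` — Abel summation with a non-increasing non-negative weight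
  (companion of the tree's `TwistedPrimeSumWindow.norm_sum_Ioc_mul_le_of_monotone`).
* `lemma56_chi_mul_inv_subwindow` — Lemma 5.6 for `χθ̄` over every sub-window `P < p ≤ u`
  (`θ` primitive mod `r`, `1 < r`, `Dr < T`, `θ ≠ χ` mod `Dr`, `|t| ≤ D`), majorant
  `C P²𝓛⁻⁷⁷e^{−𝓛^{9/2}}` — the sub-window twin of `lemma56_chi_mul_inv` (libA, `ToolkitLemma56ChiTwist`).
* `lemma56_chi_mul_inv_rpow` — the same over the full window with a real twist `p^σ`, `|σ| ≤ 5α`.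
* `lemma56_chi_mul_inv_beta` — **the general-`β` form**: for `|β| ≤ 5α` and `|t| ≤ D − 1`,
  `‖Σ_{p∼P} χ(p)θ̄(p)(pt₀)^β p^{1+it}‖ ≤ C·𝔓·e^{−𝓛^{9/2}}` (via (2.9) `P²𝓛⁻⁷⁷ ≤ 2𝔓`).

## References

* Y. Zhang, arXiv:2211.02515v1 (2022), §5 Lemma 5.6 p.26; §14 Prop. 14.1 p.76, (14.8) p.79.
  [cite: Zhang2022LandauSiegel, §5 Lemma 5.6; §14 (14.8) p.79, tex L3960]
* H. L. Montgomery, R. C. Vaughan, *Multiplicative Number Theory I*, CUP (2007), §9.1 (induced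
  characters). [cite: MontgomeryVaughan2007, §9.1]
* T. M. Apostol, *Introduction to Analytic Number Theory* (1976), Thm 4.2 (Abel's identity).
  [cite: Apostol1976, Thm 4.2]
-/

noncomputable section

open Complex Real

namespace Literature.NumberTheory.LFunctions.Zhang2022.Skeleton

open Literature.NumberTheory.LFunctions DirichletCharacter

/-! ## §1. Abel summation with a non-increasing weight -/

/-- **Discrete Abel summation, antitone non-negative weight.** If `0 ≤ g(n+1) ≤ g(n)` for `n > a`
and `‖∑_{a < n ≤ u} c(n)‖ ≤ M` for all `a ≤ u ≤ b`, then for `a < b`,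
`‖∑_{a < n ≤ b} c(n) g(n)‖ ≤ 3 M g(a+1)` (write `g = g(a+1) − g'` with `g'` non-decreasing and use the
monotone case, `TwistedPrimeSumWindow.norm_sum_Ioc_mul_le_of_monotone`) — Abel's identity with a
monotone weight. [cite: Apostol1976, Thm 4.2 (Abel's identity)] -/
theorem norm_sum_Ioc_mul_le_of_antitone {c : ℕ → ℂ} {g : ℕ → ℝ} {a b : ℕ} {M : ℝ}
    (hg0 : ∀ n, a < n → 0 ≤ g n) (hanti : ∀ n, a < n → g (n + 1) ≤ g n)
    (hA : ∀ u, a ≤ u → u ≤ b → ‖∑ n ∈ Finset.Ioc a u, c n‖ ≤ M) (hab : a < b) :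
    ‖∑ n ∈ Finset.Ioc a b, c n * (g n : ℂ)‖ ≤ 3 * M * g (a + 1) := by
  have hM : 0 ≤ M := by simpa using hA a le_rfl hab.le
  have hle : ∀ n, a < n → g n ≤ g (a + 1) := by
    intro n hn
    induction n, (show a + 1 ≤ n from hn) using Nat.le_induction with
    | base => exact le_rfl
    | succ k hk ih => exact (hanti k (by omega)).trans (ih (by omega))
  set g' : ℕ → ℝ := fun n => g (a + 1) - g n with hg'
  have h1 : ∑ n ∈ Finset.Ioc a b, c n * (g n : ℂ) =
      (g (a + 1) : ℂ) * ∑ n ∈ Finset.Ioc a b, c n - ∑ n ∈ Finset.Ioc a b, c n * (g' n : ℂ) := by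
    rw [Finset.mul_sum, ← Finset.sum_sub_distrib]
    refine Finset.sum_congr rfl fun n _ => ?_
    simp only [hg', Complex.ofReal_sub]
    ring
  have h2 := TwistedPrimeSumWindow.norm_sum_Ioc_mul_le_of_monotone (c := c) (g := g')
    (fun n hn => by simp only [hg']; linarith [hle n hn])
    (fun n hn => by simp only [hg']; linarith [hanti n hn]) hA hab
  have hgb : g' b ≤ g (a + 1) := by simp only [hg']; linarith [hg0 b hab]
  have hga : 0 ≤ g (a + 1) := hg0 (a + 1) (by omega)
  rw [h1]
  calc ‖(g (a + 1) : ℂ) * ∑ n ∈ Finset.Ioc a b, c n - ∑ n ∈ Finset.Ioc a b, c n * (g' n : ℂ)‖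
      ≤ ‖(g (a + 1) : ℂ) * ∑ n ∈ Finset.Ioc a b, c n‖ + ‖∑ n ∈ Finset.Ioc a b, c n * (g' n : ℂ)‖ :=
        norm_sub_le _ _
    _ ≤ g (a + 1) * M + 2 * M * g' b := by
        refine add_le_add ?_ h2
        rw [norm_mul, Complex.norm_real, Real.norm_of_nonneg hga]
        exact mul_le_mul_of_nonneg_left (hA b hab.le le_rfl) hga
    _ ≤ g (a + 1) * M + 2 * M * g (a + 1) := by gcongr
    _ = 3 * M * g (a + 1) := by ring

/-! ## §2. Lemma 5.6 for `χθ̄` over sub-windows -/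

/-- `D ≥ 3` gives `χ ≠ 1` for the primitive `χ` and the (A)-bound in the `(·)⁻¹` form. [folklore] -/
private theorem assumptionA_inv {D : ℕ} [NeZero D] {χ : DirichletCharacter ℂ D}
    (hA : AssumptionA D χ) : ‖χ.LFunction 1‖ < (Real.log D ^ 2022)⁻¹ := by
  rw [← one_div]; exact hA

/-- **Lemma 5.6 for `χθ̄` over every sub-window.** Under (A), for `D` large: for every `1 < r` with
`Dr < T`, every primitive `θ (mod r)` with `θ ≠ χ` (mod `Dr`), every `|t| ≤ D` and every natural
`u < ⌈P(1+𝓛⁻⁶⁸)⌉`: `‖Σ_{P<p≤u} χ(p)θ̄(p)p^{1+it}‖ ≤ C P²𝓛⁻⁷⁷e^{−𝓛^{9/2}}` (`C > 0`). Each `p` of the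
window exceeds `P ≥ T > Dr`, so `χ(p)θ̄(p) = η₀(p)` for the primitive inducer `η₀ (mod f)` of
`χ'θ'⁻¹ (mod Dr)`, `1 < f ≤ Dr < T`, `η₀ ≠ χ` — and `Zhang2022.lemma56` (sub-window form) applies to `η₀`.
[cite: Zhang2022LandauSiegel, §5 Lemma 5.6 p.26; §14 (14.8) p.79, tex L3960] -/
theorem lemma56_chi_mul_inv_subwindow :
    ∃ C : ℝ, 0 < C ∧ ForAllLarge fun D _ χ => AssumptionA D χ →
      ∀ (r : ℕ) [NeZero r], 1 < r → (D : ℝ) * r < bigT D →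
        ∀ θ : DirichletCharacter ℂ r, θ.IsPrimitive →
          changeLevel (Nat.dvd_mul_left r D) θ ≠ changeLevel (Nat.dvd_mul_right D r) χ →
          ∀ t : ℝ, |t| ≤ D → ∀ u : ℕ, u < ⌈bigP D * (1 + (ell D ^ 68)⁻¹)⌉₊ →
            ‖∑ p ∈ (Finset.Ioc ⌊bigP D⌋₊ u).filter Nat.Prime,
                χ (p : ZMod D) * θ⁻¹ (p : ZMod r) * (p : ℂ) ^ (1 + t * I)‖ ≤
              C * bigP D ^ 2 * (ell D ^ 77)⁻¹ * Real.exp (-(ell D ^ ((9 : ℝ) / 2))) := by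
  obtain ⟨D₀, C, hC, H⟩ := Zhang2022.lemma56
  refine ⟨C, hC, max D₀ 3, fun D _ χ hD hq hp hA r _ hr hrT θ hθ hne t ht u hu => ?_⟩
  have hD₀ : D₀ ≤ D := le_trans (le_max_left _ _) hD
  have hD3 : 3 ≤ D := le_trans (le_max_right _ _) hD
  have hχ1 : χ ≠ 1 := ne_one_of_isPrimitive_of_three_le hp hD3
  have hA' := assumptionA_inv hA
  haveI : NeZero (D * r) := ⟨mul_ne_zero (NeZero.ne D) (NeZero.ne r)⟩
  set η : DirichletCharacter ℂ (D * r) :=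
    changeLevel (Nat.dvd_mul_right D r) χ * (changeLevel (Nat.dvd_mul_left r D) θ)⁻¹ with hη
  haveI : NeZero η.conductor := ⟨η.conductor_ne_zero⟩
  have h1f : 1 < η.conductor := by rw [hη]; exact one_lt_conductor_mul_inv χ θ hne
  have hfDr : η.conductor ≤ D * r := conductor_le_mul η (by omega)
  have hDrT : ((D * r : ℕ) : ℝ) < bigT D := by push_cast; exact hrT
  have hfT : (η.conductor : ℝ) < bigT D := lt_of_le_of_lt (Nat.cast_le.mpr hfDr) hDrT
  have hfT' : (η.conductor : ℝ) < Real.exp (Real.log D ^ ((11 : ℝ) / 10)) := by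
    have : bigT D = Real.exp (Real.log D ^ ((11 : ℝ) / 10)) := by rw [bigT, ell]; norm_num
    rwa [this] at hfT
  have hne' := primitiveCharacter_mul_inv_ne_chi χ θ hθ hr η hη
  have hℓ0 : 0 ≤ ell D := Real.log_natCast_nonneg D
  have hRHS0 : 0 ≤ C * bigP D ^ 2 * (ell D ^ 77)⁻¹ * Real.exp (-(ell D ^ ((9 : ℝ) / 2))) :=
    mul_nonneg (mul_nonneg (mul_nonneg hC.le (sq_nonneg _)) (inv_nonneg.mpr (pow_nonneg hℓ0 _)))
      (Real.exp_pos _).le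
  -- the empty range
  rcases le_or_gt u ⌊bigP D⌋₊ with hule | hult
  · have hempty : (Finset.Ioc ⌊bigP D⌋₊ u).filter Nat.Prime = ∅ := by
      rw [Finset.filter_eq_empty_iff]
      intro n hn; rw [Finset.mem_Ioc] at hn; omega
    rw [hempty, Finset.sum_empty, norm_zero]
    exact hRHS0
  -- `P ≤ u ≤ P(1+𝓛⁻⁶⁸)`
  have hPu : bigP D ≤ u := by
    have h1 : (⌊bigP D⌋₊ : ℝ) + 1 ≤ u := by exact_mod_cast hult
    linarith [Nat.lt_floor_add_one (bigP D)]
  have huP : (u : ℝ) ≤ bigP D * (1 + (ell D ^ 68)⁻¹) := by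
    have hpos : 0 ≤ bigP D * (1 + (ell D ^ 68)⁻¹) := by
      have : 0 ≤ (ell D ^ 68)⁻¹ := inv_nonneg.mpr (pow_nonneg hℓ0 _)
      exact mul_nonneg (Real.exp_pos _).le (by linarith)
    have h1 : u ≤ ⌈bigP D * (1 + (ell D ^ 68)⁻¹)⌉₊ - 1 := by omega
    have h2 : ((⌈bigP D * (1 + (ell D ^ 68)⁻¹)⌉₊ - 1 : ℕ) : ℝ) < bigP D * (1 + (ell D ^ 68)⁻¹) := by
      have hc1 : 1 ≤ ⌈bigP D * (1 + (ell D ^ 68)⁻¹)⌉₊ := by omega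
      rw [Nat.cast_sub hc1, Nat.cast_one]
      linarith [Nat.ceil_lt_add_one hpos]
    exact le_of_lt (lt_of_le_of_lt (by exact_mod_cast h1) h2)
  -- the sum is the sum of `η₀(p)p^{1+it}`
  have hsum : ∑ p ∈ (Finset.Ioc ⌊bigP D⌋₊ u).filter Nat.Prime,
      χ (p : ZMod D) * θ⁻¹ (p : ZMod r) * (p : ℂ) ^ (1 + t * I) =
      ∑ p ∈ (Finset.Ioc ⌊bigP D⌋₊ u).filter Nat.Prime,
        η.primitiveCharacter (p : ZMod η.conductor) * (p : ℂ) ^ (1 + t * I) := by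
    refine Finset.sum_congr rfl fun p hpw => ?_
    obtain ⟨hpI, hpp⟩ := Finset.mem_filter.mp hpw
    have hPp : bigP D < p := by
      have h1 : (⌊bigP D⌋₊ : ℝ) + 1 ≤ p := by exact_mod_cast (Finset.mem_Ioc.mp hpI).1
      linarith [Nat.lt_floor_add_one (bigP D)]
    have hcop : p.Coprime (D * r) := by
      have hnp : D * r < p := by
        have : ((D * r : ℕ) : ℝ) < p := hDrT.trans_le ((bigT_le_bigP hD3).trans hPp.le)
        exact_mod_cast this
      refine (Nat.Prime.coprime_iff_not_dvd hpp).mpr fun hdvd => ?_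
      exact absurd (Nat.le_of_dvd (Nat.pos_of_ne_zero (NeZero.ne (D * r))) hdvd) (not_le.mpr hnp)
    rw [primitiveCharacter_apply_natCast η hcop, hη, changeLevel_mul_inv_apply_natCast χ θ hcop]
  rw [hsum]
  have h := H D hD₀ χ hχ1 hA' η.conductor h1f hfT' η.primitiveCharacter
    η.primitiveCharacter_isPrimitive hne' t ht u (by rw [bigP, ell] at hPu; exact hPu)
    (by rw [bigP, ell] at huP; exact huP)
  rw [Nat.floor_natCast] at h
  rw [bigP, ell]
  exact h

/-! ## §3. A real twist `p^σ`, `|σ| ≤ 5α`, by Abel summation -/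

/-- The window as a filtered `Ioc`: `{P < p < ⌈P(1+𝓛⁻⁶⁸)⌉} = {P < p ≤ ⌈P(1+𝓛⁻⁶⁸)⌉ − 1}`.
[cite: Zhang2022LandauSiegel, §2 p.4] -/
theorem primeWindow_eq_filter_Ioc (D : ℕ) :
    primeWindow D =
      (Finset.Ioc ⌊bigP D⌋₊ (⌈bigP D * (1 + (ell D ^ 68)⁻¹)⌉₊ - 1)).filter Nat.Prime := by
  rw [primeWindow, Ioo_eq_Ioc_sub_one]

/-- `(2P)^{5α} ≤ e^{10π}`-type bound: for `𝓛 ≥ 3`, `1 ≤ x ≤ 2P` and `σ ≤ 5α`, `x^σ ≤ e^{10π}`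
(`log(2P) ≤ 𝓛⁹ + 1 ≤ 2𝓛⁹`, `α𝓛⁹ = π`). [cite: Zhang2022LandauSiegel, §2 (2.6), (2.10)] -/
theorem rpow_le_exp_ten_pi {D : ℕ} (hℓ : 3 ≤ ell D) {x σ : ℝ} (hx1 : 1 ≤ x)
    (hx2 : x ≤ 2 * bigP D) (hσ : σ ≤ 5 * alpha D) : x ^ σ ≤ Real.exp (10 * π) := by
  have hℓ0 : 0 < ell D := by linarith
  have hx0 : 0 < x := by linarith
  refine (Real.rpow_le_rpow_of_exponent_le hx1 hσ).trans ?_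
  have hlog : Real.log x ≤ 2 * ell D ^ 9 := by
    have h1 : Real.log x ≤ Real.log (2 * bigP D) := Real.log_le_log hx0 hx2
    have h2 : Real.log (2 * bigP D) = Real.log 2 + ell D ^ 9 := by
      rw [bigP, Real.log_mul (by norm_num) (Real.exp_pos _).ne', Real.log_exp]
    have h3 : Real.log 2 ≤ 1 := by
      have := Real.log_two_lt_d9; linarith
    have h9 : 1 ≤ ell D ^ 9 := one_le_pow₀ (by linarith)
    linarith
  have hα : 0 < alpha D := alpha_pos' hℓ0
  have h1 : alpha D * ell D ^ 9 = π := by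
    have := alpha_mul_log_bigP (D := D) hℓ0.ne'
    rwa [show Real.log (bigP D) = ell D ^ 9 by rw [bigP, Real.log_exp]] at this
  rw [Real.rpow_def_of_pos hx0, Real.exp_le_exp]
  calc Real.log x * (5 * alpha D) ≤ 2 * ell D ^ 9 * (5 * alpha D) :=
        mul_le_mul_of_nonneg_right hlog (by positivity)
    _ = 10 * (alpha D * ell D ^ 9) := by ring
    _ = 10 * π := by rw [h1]

/-- **Lemma 5.6 for `χθ̄` with a real twist `p^σ`, `|σ| ≤ 5α`.** Under (A), for `D` large: for every
`1 < r` with `Dr < T`, primitive `θ (mod r)` with `θ ≠ χ` (mod `Dr`), `|t| ≤ D` and `|σ| ≤ 5α`: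
`‖Σ_{p∼P} χ(p)θ̄(p)p^{1+it}·p^σ‖ ≤ 3e^{10π}·C P²𝓛⁻⁷⁷e^{−𝓛^{9/2}}` — Abel summation of the monotone weight
`p^σ` (non-decreasing for `σ ≥ 0`, bounded by `(2P)^{5α} ≤ e^{10π}`; non-increasing for `σ < 0`,
bounded by `1`) against the sub-window bounds `lemma56_chi_mul_inv_subwindow`.
[cite: Zhang2022LandauSiegel, §5 Lemma 5.6 p.26; §14 Prop. 14.1 p.76 ("general case")] -/
theorem lemma56_chi_mul_inv_rpow :
    ∃ C : ℝ, 0 < C ∧ ForAllLarge fun D _ χ => AssumptionA D χ →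
      ∀ (r : ℕ) [NeZero r], 1 < r → (D : ℝ) * r < bigT D →
        ∀ θ : DirichletCharacter ℂ r, θ.IsPrimitive →
          changeLevel (Nat.dvd_mul_left r D) θ ≠ changeLevel (Nat.dvd_mul_right D r) χ →
          ∀ t : ℝ, |t| ≤ D → ∀ σ : ℝ, |σ| ≤ 5 * alpha D →
            ‖∑ p ∈ primeWindow D, χ (p : ZMod D) * θ⁻¹ (p : ZMod r) * (p : ℂ) ^ (1 + t * I) *
                (((p : ℝ) ^ σ : ℝ) : ℂ)‖ ≤
              C * bigP D ^ 2 * (ell D ^ 77)⁻¹ * Real.exp (-(ell D ^ ((9 : ℝ) / 2))) := by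
  obtain ⟨C, hC, D₀, H⟩ := lemma56_chi_mul_inv_subwindow
  obtain ⟨D₁, hD₁⟩ := exists_nat_forall_le_ell 3
  refine ⟨3 * Real.exp (10 * π) * C, by positivity, max D₀ D₁,
    fun D _ χ hD hq hp hA r _ hr hrT θ hθ hne t ht σ hσ => ?_⟩
  have hD₀ : D₀ ≤ D := le_trans (le_max_left _ _) hD
  have hℓ3 : 3 ≤ ell D := hD₁ D (le_trans (le_max_right _ _) hD)
  have hℓ1 : 1 ≤ ell D := by linarith
  have hℓ0 : 0 ≤ ell D := by linarith
  set M : ℝ := C * bigP D ^ 2 * (ell D ^ 77)⁻¹ * Real.exp (-(ell D ^ ((9 : ℝ) / 2))) with hMdef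
  have hM0 : 0 ≤ M :=
    mul_nonneg (mul_nonneg (mul_nonneg hC.le (sq_nonneg _)) (inv_nonneg.mpr (pow_nonneg hℓ0 _)))
      (Real.exp_pos _).le
  have hE1 : 1 ≤ Real.exp (10 * π) := Real.one_le_exp (by positivity)
  have hgoal : 3 * Real.exp (10 * π) * C * bigP D ^ 2 * (ell D ^ 77)⁻¹ *
      Real.exp (-(ell D ^ ((9 : ℝ) / 2))) = 3 * Real.exp (10 * π) * M := by rw [hMdef]; ring
  rw [hgoal]
  -- the window as `Ioc a b` filtered
  set a : ℕ := ⌊bigP D⌋₊ with hadef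
  set N : ℕ := ⌈bigP D * (1 + (ell D ^ 68)⁻¹)⌉₊ with hNdef
  set b : ℕ := N - 1 with hbdef
  set c : ℕ → ℂ := fun n =>
    if n.Prime then χ (n : ZMod D) * θ⁻¹ (n : ZMod r) * (n : ℂ) ^ (1 + t * I) else 0 with hcdef
  set g : ℕ → ℝ := fun n => (n : ℝ) ^ σ with hgdef
  have hwin : primeWindow D = (Finset.Ioc a b).filter Nat.Prime := primeWindow_eq_filter_Ioc D
  have hsumEq : ∑ p ∈ primeWindow D, χ (p : ZMod D) * θ⁻¹ (p : ZMod r) * (p : ℂ) ^ (1 + t * I) *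
      (((p : ℝ) ^ σ : ℝ) : ℂ) = ∑ n ∈ Finset.Ioc a b, c n * (g n : ℂ) := by
    rw [hwin, Finset.sum_filter]
    refine Finset.sum_congr rfl fun n _ => ?_
    simp only [hcdef, hgdef]
    split_ifs <;> simp
  rw [hsumEq]
  -- partial sums
  have hP1pos : 0 < bigP D * (1 + (ell D ^ 68)⁻¹) :=
    mul_pos (Real.exp_pos _) (by have : 0 ≤ (ell D ^ 68)⁻¹ := inv_nonneg.mpr (pow_nonneg hℓ0 _); linarith)
  have hN1 : 1 ≤ N := Nat.one_le_iff_ne_zero.2 (Nat.ceil_pos.2 hP1pos).ne'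
  have hpartial : ∀ u, a ≤ u → u ≤ b → ‖∑ n ∈ Finset.Ioc a u, c n‖ ≤ M := by
    intro u _ hub
    have huN : u < N := by omega
    have h := H D χ hD₀ hq hp hA r hr hrT θ hθ hne t ht u huN
    rw [Finset.sum_filter] at h
    simpa only [hcdef] using h
  rcases le_or_gt b a with hba | hab
  · have hempty : Finset.Ioc a b = ∅ := Finset.Ioc_eq_empty (by omega)
    rw [hempty, Finset.sum_empty, norm_zero]
    positivity
  -- sizes of the weight
  have hb2P : (b : ℝ) ≤ 2 * bigP D := by
    have h1 : (b : ℝ) < bigP D * (1 + (ell D ^ 68)⁻¹) := by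
      rw [hbdef, Nat.cast_sub hN1, Nat.cast_one]
      linarith [Nat.ceil_lt_add_one hP1pos.le]
    have h2 : (ell D ^ 68)⁻¹ ≤ 1 := inv_le_one_of_one_le₀ (one_le_pow₀ hℓ1)
    have hP := bigP_pos D
    nlinarith
  have hg0 : ∀ n, a < n → 0 ≤ g n := fun n _ => Real.rpow_nonneg (Nat.cast_nonneg n) σ
  rcases le_or_gt 0 σ with hσ0 | hσ0
  · -- non-decreasing weight
    have hmono : ∀ n, a < n → g n ≤ g (n + 1) := fun n _ =>
      Real.rpow_le_rpow (Nat.cast_nonneg n) (by push_cast; linarith) hσ0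
    have h := TwistedPrimeSumWindow.norm_sum_Ioc_mul_le_of_monotone hg0 hmono hpartial hab
    have hb1 : (1 : ℝ) ≤ b := by exact_mod_cast (show 1 ≤ b by omega)
    have hgb : g b ≤ Real.exp (10 * π) :=
      rpow_le_exp_ten_pi hℓ3 hb1 hb2P ((le_abs_self σ).trans hσ)
    calc ‖∑ n ∈ Finset.Ioc a b, c n * (g n : ℂ)‖ ≤ 2 * M * g b := h
      _ ≤ 2 * M * Real.exp (10 * π) := mul_le_mul_of_nonneg_left hgb (by positivity)
      _ ≤ 3 * Real.exp (10 * π) * M := by nlinarith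
  · -- non-increasing weight
    have hanti : ∀ n, a < n → g (n + 1) ≤ g n := fun n hn =>
      Real.rpow_le_rpow_of_nonpos (by exact_mod_cast (show 0 < n by omega)) (by push_cast; linarith)
        hσ0.le
    have h := norm_sum_Ioc_mul_le_of_antitone hg0 hanti hpartial hab
    have hga : g (a + 1) ≤ 1 :=
      Real.rpow_le_one_of_one_le_of_nonpos (by exact_mod_cast (show 1 ≤ a + 1 by omega)) hσ0.le
    calc ‖∑ n ∈ Finset.Ioc a b, c n * (g n : ℂ)‖ ≤ 3 * M * g (a + 1) := h
      _ ≤ 3 * M * 1 := mul_le_mul_of_nonneg_left hga (by positivity)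
      _ ≤ 3 * Real.exp (10 * π) * M := by nlinarith

/-! ## §4. The complex twist `(pt₀)^β`, `|β| ≤ 5α` -/

/-- `(pt₀)^β · p^{1+it} = t₀^β · (p^{1+i(t+Im β)} · p^{Re β})` for a positive integer `p`.
[cite: Zhang2022LandauSiegel, §14 Prop. 14.1 p.76] -/
theorem pt0_cpow_mul_cpow_eq {D p : ℕ} (hp : 0 < p) (ht0 : 0 < t0 D) (β : ℂ) (t : ℝ) :
    (((p : ℝ) * t0 D : ℝ) : ℂ) ^ β * (p : ℂ) ^ (1 + t * I) =
      ((t0 D : ℝ) : ℂ) ^ β *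
        ((p : ℂ) ^ (1 + ((t + β.im : ℝ) : ℂ) * I) * (((p : ℝ) ^ β.re : ℝ) : ℂ)) := by
  have hp0 : (0 : ℝ) ≤ p := Nat.cast_nonneg p
  have hpC : (p : ℂ) ≠ 0 := by exact_mod_cast hp.ne'
  rw [Complex.ofReal_mul, Complex.mul_cpow_ofReal_nonneg hp0 ht0.le, Complex.ofReal_natCast,
    Complex.ofReal_cpow hp0, Complex.ofReal_natCast]
  have hβ : (p : ℂ) ^ β = (p : ℂ) ^ ((β.re : ℂ)) * (p : ℂ) ^ ((β.im : ℂ) * I) := by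
    rw [← Complex.cpow_add _ _ hpC, Complex.re_add_im]
  have hsplit : (p : ℂ) ^ (1 + ((t + β.im : ℝ) : ℂ) * I) =
      (p : ℂ) ^ (1 + (t : ℂ) * I) * (p : ℂ) ^ ((β.im : ℂ) * I) := by
    rw [← Complex.cpow_add _ _ hpC]; push_cast; ring_nf
  rw [hβ, hsplit]; ring

/-- `‖t₀^β‖ ≤ e^{5π}` for `|β| ≤ 5α`, `𝓛 ≥ 3` (`t₀ = 𝓛⁵¹⁹ ≤ P`, so `t₀^{5α} ≤ P^{5α} = e^{5π}`).
[cite: Zhang2022LandauSiegel, §2 (2.8), (2.10)] -/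
theorem norm_t0_cpow_le {D : ℕ} (hℓ : 3 ≤ ell D) {β : ℂ} (hβ : ‖β‖ ≤ 5 * alpha D) :
    ‖((t0 D : ℝ) : ℂ) ^ β‖ ≤ Real.exp (10 * π) := by
  have hℓ1 : 1 ≤ ell D := by linarith
  have hℓ0 : 0 < ell D := by linarith
  have ht1 : 1 ≤ t0 D := by rw [t0]; exact one_le_pow₀ hℓ1
  have ht0 : 0 < t0 D := by linarith
  rw [Complex.norm_cpow_eq_rpow_re_of_pos ht0]
  refine rpow_le_exp_ten_pi hℓ ht1 ?_ ((Complex.re_le_norm β).trans hβ)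
  -- `t₀ = 𝓛⁵¹⁹ ≤ exp(𝓛⁹) ≤ 2P`
  have h1 : Real.log (t0 D) ≤ ell D ^ 9 := by
    rw [t0, Real.log_pow]
    have h2 : Real.log (ell D) ≤ ell D := (Real.log_le_sub_one_of_pos hℓ0).trans (by linarith)
    have h8 : (519 : ℝ) ≤ ell D ^ 8 :=
      calc (519 : ℝ) ≤ 3 ^ 8 := by norm_num
        _ ≤ ell D ^ 8 := pow_le_pow_left₀ (by norm_num) hℓ 8
    calc (519 : ℕ) * Real.log (ell D) ≤ 519 * ell D := by
          push_cast; exact mul_le_mul_of_nonneg_left h2 (by norm_num)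
      _ ≤ ell D ^ 8 * ell D := mul_le_mul_of_nonneg_right h8 hℓ0.le
      _ = ell D ^ 9 := by ring
  have h2 : t0 D ≤ bigP D := by
    rw [bigP, ← Real.exp_log ht0]; exact Real.exp_le_exp.mpr h1
  linarith [bigP_pos D]

/-- **Lemma 5.6 for `χθ̄` with the twist `(pt₀)^β`, `|β| ≤ 5α`** — the `p`-sum of (14.8)/(14.6)
at general `β` (Prop. 14.1, "the general case is almost identical"). Under (A), for `D` large: for
every `1 < r` with `Dr < T`, primitive `θ (mod r)` with `θ ≠ χ` (mod `Dr`), `|β| ≤ 5α` and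
`|t| ≤ D − 1`: `‖Σ_{p∼P} χ(p)θ̄(p)(pt₀)^β p^{1+it}‖ ≤ C·𝔓·e^{−𝓛^{9/2}}`. Proof: `(pt₀)^β p^{1+it} =
t₀^β · p^{1+i(t+Im β)} · p^{Re β}` with `|t + Im β| ≤ D`, `|Re β| ≤ 5α`, `‖t₀^β‖ ≤ e^{10π}`
(`lemma56_chi_mul_inv_rpow`, `norm_t0_cpow_le`), and `P²𝓛⁻⁷⁷ ≤ 2𝔓` by (2.9) (`frakP_bounds`).
[cite: Zhang2022LandauSiegel, §5 Lemma 5.6 p.26; §14 Prop. 14.1 p.76, (14.8) p.79, tex L3960] -/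
theorem lemma56_chi_mul_inv_beta :
    ∃ C : ℝ, 0 < C ∧ ForAllLarge fun D _ χ => AssumptionA D χ →
      ∀ (r : ℕ) [NeZero r], 1 < r → (D : ℝ) * r < bigT D →
        ∀ θ : DirichletCharacter ℂ r, θ.IsPrimitive →
          changeLevel (Nat.dvd_mul_left r D) θ ≠ changeLevel (Nat.dvd_mul_right D r) χ →
          ∀ β : ℂ, ‖β‖ ≤ 5 * alpha D → ∀ t : ℝ, |t| ≤ D - 1 →
            ‖∑ p ∈ primeWindow D, χ (p : ZMod D) * θ⁻¹ (p : ZMod r) *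
                (((p : ℝ) * t0 D : ℝ) : ℂ) ^ β * (p : ℂ) ^ (1 + t * I)‖ ≤
              C * frakP D * Real.exp (-(ell D ^ ((9 : ℝ) / 2))) := by
  obtain ⟨C, hC, D₀, H⟩ := lemma56_chi_mul_inv_rpow
  obtain ⟨D₁, hD₁⟩ := exists_nat_forall_le_ell 5
  obtain ⟨D₂, HP⟩ := frakP_bounds
  refine ⟨2 * Real.exp (10 * π) * C, by positivity, max (max D₀ D₁) D₂,
    fun D _ χ hD hq hp hA r _ hr hrT θ hθ hne β hβ t ht => ?_⟩
  have hD₀ : D₀ ≤ D := le_trans (le_trans (le_max_left _ _) (le_max_left _ _)) hD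
  have hℓ5 : 5 ≤ ell D := hD₁ D (le_trans (le_trans (le_max_right _ _) (le_max_left _ _)) hD)
  have hℓ3 : 3 ≤ ell D := by linarith
  have hD₂ : D₂ ≤ D := le_trans (le_max_right _ _) hD
  have hℓ1 : 1 ≤ ell D := by linarith
  have hℓ0 : 0 ≤ ell D := by linarith
  have ht0 : 0 < t0 D := by rw [t0]; positivity
  -- the parameters of the real-twist lemma
  have hα1 : 5 * alpha D ≤ 1 := by
    have h := alpha_mul_ell_le_one (D := D) (by linarith)
    have hα0 : 0 < alpha D := alpha_pos' (by linarith)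
    nlinarith
  have ht' : |t + β.im| ≤ D := by
    have h1 : |β.im| ≤ 5 * alpha D := (Complex.abs_im_le_norm β).trans hβ
    have h2 : |t + β.im| ≤ |t| + |β.im| := abs_add_le _ _
    linarith
  have hσ : |β.re| ≤ 5 * alpha D := (Complex.abs_re_le_norm β).trans hβ
  have h := H D χ hD₀ hq hp hA r hr hrT θ hθ hne (t + β.im) ht' β.re hσ
  -- rewrite the sum
  have hsumEq : ∑ p ∈ primeWindow D, χ (p : ZMod D) * θ⁻¹ (p : ZMod r) *
      (((p : ℝ) * t0 D : ℝ) : ℂ) ^ β * (p : ℂ) ^ (1 + t * I) =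
      ((t0 D : ℝ) : ℂ) ^ β * ∑ p ∈ primeWindow D, χ (p : ZMod D) * θ⁻¹ (p : ZMod r) *
        (p : ℂ) ^ (1 + ((t + β.im : ℝ) : ℂ) * I) * (((p : ℝ) ^ β.re : ℝ) : ℂ) := by
    rw [Finset.mul_sum]
    refine Finset.sum_congr rfl fun p hpw => ?_
    have hp0 : 0 < p := (Finset.mem_filter.mp hpw).2.pos
    rw [mul_assoc (χ (p : ZMod D) * θ⁻¹ (p : ZMod r)), pt0_cpow_mul_cpow_eq hp0 ht0 β t]
    ring
  rw [hsumEq, norm_mul]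
  -- `P²𝓛⁻⁷⁷ ≤ 2𝔓`
  have hfr := HP D hD₂
  rw [abs_le] at hfr
  have hunit0 : 0 ≤ Real.exp (Real.log D ^ 9) ^ 2 * (Real.log D ^ 77)⁻¹ := by positivity
  have h68 : 3 * (Real.log D ^ 68)⁻¹ ≤ 1 / 2 := by
    have hL : (3 : ℝ) ≤ Real.log D := hℓ3
    rw [show 3 * (Real.log D ^ 68)⁻¹ = 3 / Real.log D ^ 68 by ring,
      div_le_div_iff₀ (by positivity) (by norm_num)]
    have : (3 : ℝ) ^ 68 ≤ Real.log D ^ 68 := pow_le_pow_left₀ (by norm_num) hL 68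
    nlinarith
  have hfrakP : bigP D ^ 2 * (ell D ^ 77)⁻¹ ≤ 2 * frakP D := by
    have hx := mul_le_mul_of_nonneg_right h68 hunit0
    rw [bigP, ell]; linarith [hfr.1]
  have hexp0 : 0 ≤ Real.exp (-(ell D ^ ((9 : ℝ) / 2))) := (Real.exp_pos _).le
  calc ‖((t0 D : ℝ) : ℂ) ^ β‖ * ‖∑ p ∈ primeWindow D, χ (p : ZMod D) * θ⁻¹ (p : ZMod r) *
          (p : ℂ) ^ (1 + ((t + β.im : ℝ) : ℂ) * I) * (((p : ℝ) ^ β.re : ℝ) : ℂ)‖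
      ≤ Real.exp (10 * π) * (C * bigP D ^ 2 * (ell D ^ 77)⁻¹ * Real.exp (-(ell D ^ ((9 : ℝ) / 2)))) :=
        mul_le_mul (norm_t0_cpow_le hℓ3 hβ) h (norm_nonneg _) (Real.exp_pos _).le
    _ = Real.exp (10 * π) * C * (bigP D ^ 2 * (ell D ^ 77)⁻¹) * Real.exp (-(ell D ^ ((9 : ℝ) / 2))) := by
        ring
    _ ≤ Real.exp (10 * π) * C * (2 * frakP D) * Real.exp (-(ell D ^ ((9 : ℝ) / 2))) :=
        mul_le_mul_of_nonneg_right (mul_le_mul_of_nonneg_left hfrakP (by positivity)) hexp0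
    _ = 2 * Real.exp (10 * π) * C * frakP D * Real.exp (-(ell D ^ ((9 : ℝ) / 2))) := by ring

end Literature.NumberTheory.LFunctions.Zhang2022.Skeleton
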